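import Summits.Schanuel.Schanuel.Theorems.RootDecomp1KExhibitDescent03

/-!
# RootDecomp1KSectorSubspace — lens 1, generation 70, NODE 30 «THE (4,2)-SECTOR BOX WITH SIMPLE EDGE ROOTS IS SUBSPACE» (×0-AS-RECORD, CONDITIONAL LANE — PRICE L3112, RULING L3115 (4); CLAIM L3110, NODE L3125, VERDICT L3131): for the (4,2)-sector box `boxP q` = (Y⁴ + δY³ + ζ₂Y² + ζ₁Y + ζ₀) + x·(αY² + βY + ε) + γ·x² with γ ODD and the edge quartic W⁴ + αW² + γ SEPARABLE, WINDOW LEVEL-FINITENESS and hence `LevelFinite` / `ThinFibreAt m₀` for every m₀ MODULO the route's existing binder `PadicSubspace` (hypothesis `hS`, never an axiom): `window_levels_finite`, `levelFinite_box_of_padicSubspace`, `thinFibreAt_box_of_padicSubspace`; node 11's second-order Subspace lever (tree `Lform` / `Mform` / `nearest_root` / `isAlgebraic_corr` BY NAME) transplanted to the (∞,∞) sector and closed by `transcendental_liouvilleNumber`; (H7) the GENERIC member (separable Δ_x) is node 23's — `thinFibreAt_box_of_separable_pDisc` hypothesis-free, `domHyper_box_iff`, `thinFibreAt_box_dichotomy`;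 consistency probe ρ1 (`thinFibreAt_rho1_of_padicSubspace`, unconditional by node 28); specimen M30 = (Y⁴ − Y³ − 6Y² + 2Y + 15) + x·(4Y² + Y − 27) + 11x² (singular at (1,1), ¬DomHyper, not split in the given coordinates, split after translation): `thinFibreAt_m30_of_padicSubspace` — part 1 (RootDecomp1KSectorSubspace01): # §0  Local 2-adic bookkeeping · # §1  The class: the (4,2)-sector box, its level equation and its SHAPE — 25 declarations `norm_two_ss` … `eventually_K₀_small_ss`

(lens-1 g70 NODE 30 «THE (4,2)-SECTOR BOX WITH SIMPLE EDGE ROOTS IS SUBSPACE» L3125: HOME kernel K = HOME/decomp-schanuel-lens-1/g70/lean/SectorSubspace.lean sha256 30de2f8e…, 1334 l, 87 decls (78 theorems + 8 defs + 1 structure `SectorBox`), ONE namespace `Summit.Schanuel.Schanuel.Theorems.RootDecomp1KSectorSubspace`, imports the tree port …RootDecomp1KExhibitDescent03 ONLY (node 29's record port; `PadicSubspace` / `Lform` / `Mform` / `nearest_root` / `isAlgebraic_corr` (SubspaceBranch), `rho1` (SectorTheorem), `pDisc` / `DomHyper` / `thinFibreAt_dom2` (HyperellipticSiegel), `thinFibreAt_of_levelFinite`,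 `tendsto_partialSum_two` BY TREE NAME); no private / instance / set_option / notation / sorry / new axiom; the binder `PadicSubspace` appears ONLY as the hypothesis `hS` of the `…_of_padicSubspace` heads; lens farm rc 0 · 0 errors · 0 sorries · 99 dupNamespace, `--axioms` standard on 13 heads, Probe g70/out/Probe.lean e9bf9f63… rc 0 (rfl pins @PadicSubspace = tree, @rho1 = tree, @pDisc / @DomHyper / @LevelFinite = tree), CONTROL ProbeCtrl ec7805c4… rc 1 as designed, memo g70/NODE-g70.md 51b8502c…, SHA256SUMS 23/23; CLAIM L3110 (ASK-FIRST; conditional class theorem, no new binder, no exhibit); crit g12 PRICE 30 L3112: ×0-AS-RECORD, PORT WELCOME (conditional lane, like W4Dossier01 — K-R56 (ii)/(iii), the W4 precedent RULING L2988, K-R58 (iii): the binder PROVED is the one payable head), CHECKLIST K-g70 (H1)–(H6) + (S), W-30-1; writer g36 NOTE 4 L3113 (arithmetic pre-check 11/11 on 122 472 cleared quartics); census INSTRUMENT NOTE 48 L3114 (CE-25-1: the residue exhibits of record were DomHyper) and crit RULING L3115 ((3) ERRATUM E7 FIXED; (4) PRICE 30 REFINED: the box ∩ {{Δ_x separable}}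 is ALREADY DECIDED UNCONDITIONALLY by node 23's `thinFibreAt_dom2`, node 30's proper conditional reach = the SINGULAR members (α)/(β), CHECKLIST += (H7)); writer NOTE 5 L3123 (exhaustive box census 15 309: separable 14 498 / inseparable 811); census LIVENESS-v43 key box30 (rows 63 rho1 / 70 ρ1′ / 73 specimen); crit g13 VERDICT 30 L3131: «×0-AS-RECORD — BOOKED as priced (PRICE L3112, RULING L3115 (4)); CHECKLIST K-g70 (H1)–(H7) + (S) MET; NO objection to any kernel statement; three errata-lite in PROSE only (e30-2 lens, e30-3 writer, CE-25-2 census), all on the abscissa convention — zero kernel and zero record consequence; decl census 90 = 81 theorems + 8 defs + 1 structure (the three @[simp] lemmas svec_zero/one/two counted); --axioms on 33 heads standard, PadicSubspace ONLY as the explicit binder hS; RECORD AT VERDICT 30: Dom(PadicSubspace) map entry := {node 11 SepTopAt classes, W4, node-30 box ∖ DomHyper}, the DomHyper part printed in the UNCONDITIONAL lane as node 23 (H7); open territory / exhibits VACANT / ledger / tally UNCHANGED; PORT GO (conditional lane, W4Dossier01 precedent; every …_of_padicSubspace head keeps (hS : PadicSubspace) explicit; statements byte-verbatim to K; e30-2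 docstring clause at the census choice — carried VERBATIM here, e30-2 standing in the errata list)». Port by census-1 gen 25 as `RootDecomp1KSectorSubspace01–05` (files ≤ 400 lines; `--supports stmt-Schanuel-33364`, the item stays OPEN; ×0 record port in the CONDITIONAL lane — every `…_of_padicSubspace` head carries the hypothesis `hS : PadicSubspace` explicitly (W4Dossier01 precedent); no credit anywhere; record effect at VERDICT 30 = the MAP entry Dom(PadicSubspace) ∪= node-30 box ∖ DomHyper, the DomHyper part in the unconditional lane (node 23)): 01 = K l.1–384 of the prepped source (opens # §0 / # §1) — 25 decls `norm_two_ss`, `norm_two_pow_ss`, `norm_intCast_le_one_ss`, …, `eventually_K₀_small_ss`; 02 = K l.385–688 of the prepped source (opens # §2 / # §3 / # §4 / # §5) — 16 decls `level_shape`, `level_padic`, `first_order`, …, `sector_arith`; 03 = K l.689–1000 of the prepped source (opens # §6) — 10 decls `bev_boxP_liouville_ne_zero`, `no_point_near`, `level_le_two_mul_pow`, …, `thinFibreAt_box_of_padicSubspace'`; 04 = K l.1001–1321 of the prepped source (opens # §7 / # §8 / # §9) — 37 decls `level_second_order`, `rho1Box`, `boxC_rho1Box`, …, `domHyper_box_iff`;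 05 = K l.1322–1331 of the prepped source (inside # §9) — 1 decls `thinFibreAt_box_dichotomy`. 0 one-line docstrings synthesised for undocumented helper declarations (statements quoted); everything else = K VERBATIM (statements, names, proofs, K's module docstring kept in part 01 below this provenance block).)
-/

/-!
# RootDecomp1KSectorSubspace — lens 1, generation 70, NODE 30 «THE (4,2)-SECTOR BOX WITH SIMPLE EDGE ROOTS IS SUBSPACE»

A CLASS theorem modulo the route's EXISTING binder `PadicSubspace` (node 11, `RootDecomp1KSubspaceBranch`; Schlickewei's
p-adic Subspace Theorem, a theorem in print) — no new binder, no exhibit, no new axiom.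

THE CLASS («box30»).  The dominant `k = 2`, `n = 4` box of record: `P = xPolyP 2 c` with
`c₀ = Y⁴ + δY³ + ζ₂Y² + ζ₁Y + ζ₀` (monic quartic), `c₁ = αY² + βY + ε` (`deg ≤ 2`), `c₂ = γ` an ODD constant, whose
EDGE QUARTIC `f = W⁴ + αW² + γ` (the weight-`4` edge `Y⁴ — xY² — x²` of the Newton polygon, `wt Y = 1`, `wt x = 2`) is
SEPARABLE over `ℚ` (`boxP q`, `q : SectorBox`).  Excluded (class boundary, not touched): the double-edge-root (ρ2)
types `f = (W² − c)²`, `γ` even, non-monic tops.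

THE THEOREM.  `PadicSubspace →` for every `q` as above and every window `|r| ≤ C` there is `N₀` such that NO rational
`r` with `|r| ≤ C` lies on a level `N ≥ N₀` of `boxP q` (`window_levels_finite`: WINDOW LEVEL-FINITENESS, which IS
the record's `LevelFinite` — `levelSet_box_subset_of_padicSubspace`, `levelFinite_box_of_padicSubspace`,
`bddLevelEmpty_box_of_padicSubspace`), hence `ThinFibreAt m₀ (boxP q)` for EVERY `m₀`
(`thinFibreAt_box_of_padicSubspace`).

REACH (honest).  A box member with SEPARABLE `x`-discriminant `Δ_x = c₁² − 4γc₀` is already decided UNCONDITIONALLY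
by node 23 (`thinFibreAt_of_domHyper` / `thinFibreAt_dom2`, tree `RootDecomp1KHyperellipticSiegel`) — re-derived
here for the box HYPOTHESIS-FREE as `thinFibreAt_box_of_separable_pDisc` / `levelFinite_box_of_separable_pDisc` (§9,
(H7): `DomZero 2` and `deg Δ_x = 4` are automatic, `domZero_boxC`, `coeff_pDisc_boxC_four`), and that is the GENERIC
member (critic's sample: 3 947 of 3 953); the dichotomy is `thinFibreAt_box_dichotomy`.  The stratum-ρ1
member of record `Y⁴ + x·Y − 17·x²` (`rho1 = quartC 17`) is decided UNCONDITIONALLY by node 28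
(`RootDecomp1KResidueDescent.thinFibreAt_rho1`) and is re-decided here only as a CONSISTENCY PROBE (§7).  What the
node adds is the SINGULAR simple-edge members (`Δ_x` inseparable, `f` separable), uniformly and by one mechanism;
the SPECIMEN `M30 = (Y⁴ − Y³ − 6Y² + 2Y + 15) + x·(4Y² + Y − 27) + 11·x²` (§8: `γ` odd, `f = W⁴ + 4W² + 11`
separable, `Δ_x = (Y − 1)²(−28Y² − 4Y + 69)` inseparable so `¬ DomHyper`, `c₀ ⊥ c₁` so not split form) is decided
here MODULO `PadicSubspace` (`thinFibreAt_m30_of_padicSubspace`, `levelFinite_m30_of_padicSubspace`) and by no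
landed engine's class predicate that this file can evaluate.  Every ρ1 member of the box is CONDITIONALLY decided;
the route's exhibit slots stay VACANT.

MECHANISM = node 11's second-order Subspace transplanted from the finite simple points over `x = ∞` to the SECTOR at
`(∞, ∞)`.  (§1) SHAPE (node 29's `shape6` widened to nine coefficients): on the level `x = s_N = p_N/2^{2m}`
(`2m = N!`, every `N ≥ 2`) a rational point has `den r = 2^m`, `W := num r` odd, and `W` solves the reduced integer
equation `redLHS q N m W = 0` (`level_shape`).  (§2) In `ℂ₂`, for EVERY `N ≥ 2`: `‖f(W) + 2^m·g(W)‖₂ ≤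
2^{−(N! − (N−1)!)}` (`level_padic`; `g = δW³ + βW`; `p_N ≡ 1 mod 2^{N!−(N−1)!}`, tree `norm_psNumer_sub_one`), so
`‖f(W)‖₂ ≤ 2^{−m}` (`first_order`, as `m ≤ N! − (N−1)!`), `W` is `2^{−m}`-close to a simple root `ξ` of `f` (tree
`nearest_root`), and to SECOND order `‖(W − ξ) + 2^m·γ_ξ‖₂ ≤ K·2^{−(N!−(N−1)!)}` with the algebraic correction
`γ_ξ = g(ξ)/f′(ξ)` (`second_order`, packaged with the root set as `level_second_order`; tree Taylor tools
`norm_sub_taylor_two_le`, `norm_sub_aeval_le`, `isAlgebraic_corr`).  (§3–§4) The integer vector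
`x = (num r, 1, den r)` with the tree's forms `Lform` / `Mform ξ γ_ξ` BY NAME (`Lform_isAlgebraic`,
`Mform_isAlgebraic`, `Lform_linearIndependent`, `Mform_linearIndependent`) satisfies Schlickewei's inequality with
`n = 3`, `q = 2` at EVERY window point of a large level (`den³·η² ≍ 2^{3m − 2(N!−(N−1)!)} = 2^{2(N−1)! − N!/2} → 0`;
no clause is needed), so lies in one of finitely many rational subspaces `a₀·num r + a₁ + a₂·den r = 0`.
(§5) CLOSING without Diophantine input (`sector_subspace_levels_finite`): `a₀ = 0` pins `den r = 2^m` to finitely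
many levels; otherwise `r = κ + λ/2^m` with `κ = −a₁/a₀`, `λ = −a₂/a₀ ∈ ℚ`, so `(s_N, r) → (ℓ₂, κ)` (tree
`tendsto_partialSum_two`) while `P(ℓ₂, κ) = A + B·ℓ₂ + γ·ℓ₂² ≠ 0` (`γ ≠ 0`, `ℓ₂` transcendental — Mathlib
`transcendental_liouvilleNumber`) and `P` is jointly continuous: no such points on large levels.

HONESTY.  Rung 0.  33364 / 33363 / 31077 / 31987 / `Schanuel` UNMOVED; `ThinFibre 2` NOT proved; everything named
`…_of_padicSubspace` is CONDITIONAL on `PadicSubspace` exactly as node 11 / the W4 dossier (hypothesis, never an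
axiom); §1–§5 and §8's algebra (`level_shape`, `level_padic`, `first_order`, `second_order`, `level_second_order`,
`sector_subspace_levels_finite`, `edgeF_m30Box_separable`, `pDisc_m30Box_not_separable`, `not_domHyper_m30`,
`isCoprime_m30_c0_c1`) and all of §9 are hypothesis-free.  Import: tree `RootDecomp1KExhibitDescent03` only (its closure carries
SubspaceBranch, XLinearII, XLinear, HyperellipticSiegel, LevelFinite, HeightGrading, ResidueDescent, SectorTheorem,
DigitPincer, TwoBaseCell).  0 sorry · no axiom / private / instance / notation / set_option.
-/

noncomputable section

namespace Summit.Schanuel.Schanuel.Theorems.RootDecomp1KSectorSubspace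

open Polynomial LiouvilleNumber
open scoped Nat
open Summit.Schanuel.Schanuel.Theorems.RootDecomp1KTwoBaseCell (psNumer partialSum_eq_psNumer_div coprime_psNumer)
open Summit.Schanuel.Schanuel.Theorems.RootDecomp1KRelLiouvilleCell (partialSum_two_strictMono)
open Summit.Schanuel.Schanuel.Theorems.RootDecomp1KDegreeLadder
open Summit.Schanuel.Schanuel.Theorems.RootDecomp1KXLinearCore
open Summit.Schanuel.Schanuel.Theorems.RootDecomp1KXLinear
open Summit.Schanuel.Schanuel.Theorems.RootDecomp1KXLinearII
open Summit.Schanuel.Schanuel.Theorems.RootDecomp1KXTop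
open Summit.Schanuel.Schanuel.Theorems.RootDecomp1KSubspaceBranch
open Summit.Schanuel.Schanuel.Theorems.RootDecomp1KDigitPincer (odd_psNumer_two)
open Summit.Schanuel.Schanuel.Theorems.RootDecomp1KSectorTheorem (rho1 tendsto_partialSum_two)
open Summit.Schanuel.Schanuel.Theorems.RootDecomp1KHyperellipticSiegel (pDisc DomHyper domHyper_xPolyP_iff thinFibreAt_dom2 levelFinite_dom2)
open Summit.Schanuel.Schanuel.Theorems.RootDecomp1KIntegrality (DomZero)
open Summit.Schanuel.Schanuel.Theorems.RootDecomp1KLevelFinite (LevelSet LevelFinite thinFibreAt_of_levelFinite)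
open Summit.Schanuel.Schanuel.Theorems.RootDecomp1KHeightGrading (BddLevelEmpty bddLevelEmpty_iff_levelFinite)

/-! ### §0  Local 2-adic bookkeeping -/

/-- `‖2‖₂ = 1/2` in `ℂ₂`. -/
theorem norm_two_ss : ‖(2 : PadicAlgCl 2)‖ = 1 / 2 := by
  have h1 : ((2 : ℕ) : PadicAlgCl 2) = algebraMap ℚ_[2] (PadicAlgCl 2) ((2 : ℕ) : ℚ_[2]) :=
    (map_natCast _ 2).symm
  have h2 : ‖((2 : ℕ) : ℚ_[2])‖ = (↑(2 : ℕ) : ℝ)⁻¹ := Padic.norm_p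
  have h3 : ‖((2 : ℕ) : PadicAlgCl 2)‖ = 1 / 2 := by rw [h1, PadicAlgCl.norm_extends, h2]; norm_num
  simpa using h3

/-- `‖2^t‖₂ = 2^{−t}`. -/
theorem norm_two_pow_ss (t : ℕ) : ‖(2 : PadicAlgCl 2) ^ t‖ = (1 / 2 : ℝ) ^ t := by
  rw [norm_pow, norm_two_ss]

/-- `‖z‖₂ ≤ 1` for integers. -/
theorem norm_intCast_le_one_ss (z : ℤ) : ‖(z : PadicAlgCl 2)‖ ≤ 1 := by
  have h1 : (z : PadicAlgCl 2) = algebraMap ℚ_[2] (PadicAlgCl 2) (z : ℚ_[2]) := (map_intCast _ z).symm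
  rw [h1, PadicAlgCl.norm_extends]
  exact Padic.norm_int_le_one z

/-- `‖n‖₂ ≤ 1` for naturals. -/
theorem norm_natCast_le_one_ss (n : ℕ) : ‖(n : PadicAlgCl 2)‖ ≤ 1 := by
  have := norm_intCast_le_one_ss (n : ℤ)
  simpa using this

/-- ultrametric bookkeeping: `‖a + b‖ ≤ B` from `‖a‖, ‖b‖ ≤ B`. -/
theorem ultra_add {a b : PadicAlgCl 2} {B : ℝ} (ha : ‖a‖ ≤ B) (hb : ‖b‖ ≤ B) : ‖a + b‖ ≤ B :=
  (IsUltrametricDist.norm_add_le_max a b).trans (max_le ha hb)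

/-- ultrametric bookkeeping: `‖a − b‖ ≤ B` from `‖a‖, ‖b‖ ≤ B`. -/
theorem ultra_sub {a b : PadicAlgCl 2} {B : ℝ} (ha : ‖a‖ ≤ B) (hb : ‖b‖ ≤ B) : ‖a - b‖ ≤ B := by
  rw [sub_eq_add_neg]
  exact ultra_add ha (by rwa [norm_neg])

/-- `‖x·y·z‖ ≤ B` when `‖x‖, ‖z‖ ≤ 1` and `‖y‖ ≤ B`. -/
theorem norm_mul3_le {x y z : PadicAlgCl 2} {B : ℝ} (hx : ‖x‖ ≤ 1) (hy : ‖y‖ ≤ B) (hz : ‖z‖ ≤ 1) (hB : 0 ≤ B) :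
    ‖x * y * z‖ ≤ B := by
  rw [norm_mul, norm_mul]
  calc ‖x‖ * ‖y‖ * ‖z‖ ≤ 1 * B * 1 := by gcongr
    _ = B := by ring

/-! ### §1  The class: the (4,2)-sector box, its level equation and its SHAPE -/

/-- the nine integer coefficients of a member `Y⁴ + δY³ + ζ₂Y² + ζ₁Y + ζ₀ + x·(αY² + βY + ε) + γ·x²` of the
dominant `k = 2`, `n = 4` box. -/
structure SectorBox where
  /-- coefficient of `Y³` -/
  δ : ℤ
  /-- coefficient of `Y²` -/
  ζ₂ : ℤ
  /-- coefficient of `Y` -/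
  ζ₁ : ℤ
  /-- constant coefficient -/
  ζ₀ : ℤ
  /-- coefficient of `x·Y²` -/
  α : ℤ
  /-- coefficient of `x·Y` -/
  β : ℤ
  /-- coefficient of `x` -/
  ε : ℤ
  /-- coefficient of `x²` -/
  γ : ℤ

/-- the `x`-coefficient vector: `c₀ = Y⁴ + δY³ + ζ₂Y² + ζ₁Y + ζ₀`, `c₁ = αY² + βY + ε`, `c₂ = γ`. -/
def boxC (q : SectorBox) (j : ℕ) : ℤ[X] :=
  if j = 0 then X ^ 4 + C q.δ * X ^ 3 + C q.ζ₂ * X ^ 2 + C q.ζ₁ * X + C q.ζ₀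
  else if j = 1 then C q.α * X ^ 2 + C q.β * X + C q.ε
  else if j = 2 then C q.γ else 0

/-- the box member as a curve `P ∈ ℤ[x][Y]` of `x`-degree `2` (tree `xPolyP`). -/
def boxP (q : SectorBox) : ℤ[X][X] := xPolyP 2 (boxC q)

/-- `: boxC q 0 = X ^ 4 + C q.δ * X ^ 3 + C q.ζ₂ * X ^ 2 + C q.ζ₁ * X + C q.ζ₀`. -/
theorem boxC_zero (q : SectorBox) : boxC q 0 = X ^ 4 + C q.δ * X ^ 3 + C q.ζ₂ * X ^ 2 + C q.ζ₁ * X + C q.ζ₀ := by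
  simp [boxC]

/-- `: boxC q 1 = C q.α * X ^ 2 + C q.β * X + C q.ε`. -/
theorem boxC_one (q : SectorBox) : boxC q 1 = C q.α * X ^ 2 + C q.β * X + C q.ε := by simp [boxC]

/-- `: boxC q 2 = C q.γ`. -/
theorem boxC_two (q : SectorBox) : boxC q 2 = C q.γ := by simp [boxC]

/-- the values of the box member: `P(x, y) = y⁴ + δy³ + ζ₂y² + ζ₁y + ζ₀ + x·(αy² + βy + ε) + γ·x²`. -/
theorem bev_boxP (q : SectorBox) (x y : ℝ) :
    bev (boxP q) x y = y ^ 4 + q.δ * y ^ 3 + q.ζ₂ * y ^ 2 + q.ζ₁ * y + q.ζ₀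
      + x * (q.α * y ^ 2 + q.β * y + q.ε) + q.γ * x ^ 2 := by
  rw [boxP, bev_xPolyP]
  simp [Finset.sum_range_succ, boxC_zero, boxC_one, boxC_two]
  ring

/-- the EDGE QUARTIC of the box: `f = W⁴ + α·W² + γ` (the weight-`4` edge `Y⁴ — x·Y² — x²`). -/
def edgeF (q : SectorBox) : ℤ[X] := X ^ 4 + C q.α * X ^ 2 + C q.γ

/-- the SUB-EDGE cubic of the box: `g = δ·W³ + β·W` (the weight-`3` terms `Y³`, `x·Y`). -/
def subG (q : SectorBox) : ℤ[X] := C q.δ * X ^ 3 + C q.β * X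

/-- `: (edgeF q).natDegree = 4`. -/
theorem natDegree_edgeF (q : SectorBox) : (edgeF q).natDegree = 4 := by
  unfold edgeF; compute_degree!

/-- `: edgeF q ≠ 0`. -/
theorem edgeF_ne_zero (q : SectorBox) : edgeF q ≠ 0 := by
  intro h
  have := natDegree_edgeF q
  rw [h, natDegree_zero] at this
  exact absurd this (by norm_num)

/-- `: (subG q).natDegree ≤ 3`. -/
theorem natDegree_subG_le (q : SectorBox) : (subG q).natDegree ≤ 3 := by
  unfold subG; compute_degree

/-- `(z : PadicAlgCl 2) : aeval z (edgeF q) = z ^ 4 + q.α * z ^ 2 + q.γ`. -/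
theorem aeval_edgeF (q : SectorBox) (z : PadicAlgCl 2) : aeval z (edgeF q) = z ^ 4 + (q.α : PadicAlgCl 2) * z ^ 2 + q.γ := by
  simp [edgeF]

/-- `(z : PadicAlgCl 2) : aeval z (subG q) = q.δ * z ^ 3 + q.β * z`. -/
theorem aeval_subG (q : SectorBox) (z : PadicAlgCl 2) : aeval z (subG q) = (q.δ : PadicAlgCl 2) * z ^ 3 + q.β * z := by
  simp [subG]

/-- (P1) the INTEGER level equation of the box member at `x = p/2^{2m}`, `Y = r = a/d`:
`2^{4m}·(a⁴ + δa³d + ζ₂a²d² + ζ₁ad³ + ζ₀d⁴) + 2^{2m}·p·(αa²d² + βad³ + εd⁴) + γp²d⁴ = 0`, written out term by term. -/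
theorem int_eq9 (q : SectorBox) (p : ℤ) (m : ℕ) (r : ℚ) (h : bev (boxP q) ((p : ℝ) / 2 ^ (2 * m)) r = 0) :
    r.num ^ 4 * 2 ^ (4 * m) + q.δ * r.num ^ 3 * (r.den : ℤ) * 2 ^ (4 * m)
      + q.ζ₂ * r.num ^ 2 * (r.den : ℤ) ^ 2 * 2 ^ (4 * m) + q.ζ₁ * r.num * (r.den : ℤ) ^ 3 * 2 ^ (4 * m)
      + q.ζ₀ * (r.den : ℤ) ^ 4 * 2 ^ (4 * m)
      + q.α * p * r.num ^ 2 * (r.den : ℤ) ^ 2 * 2 ^ (2 * m)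
      + q.β * p * r.num * (r.den : ℤ) ^ 3 * 2 ^ (2 * m) + q.ε * p * (r.den : ℤ) ^ 4 * 2 ^ (2 * m)
      + q.γ * p ^ 2 * (r.den : ℤ) ^ 4 = 0 := by
  rw [bev_boxP] at h
  have hnum : ((r.num : ℚ) : ℝ) = (r : ℝ) * (r.den : ℝ) := by
    have e : ((r * r.den : ℚ) : ℝ) = ((r.num : ℚ) : ℝ) := by rw [Rat.mul_den_eq_num]
    push_cast at e ⊢
    exact e.symm
  push_cast at hnum
  have h2 : (2 : ℝ) ^ (2 * m) ≠ 0 := pow_ne_zero _ two_ne_zero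
  have key : ((r.num ^ 4 * 2 ^ (4 * m) + q.δ * r.num ^ 3 * (r.den : ℤ) * 2 ^ (4 * m)
      + q.ζ₂ * r.num ^ 2 * (r.den : ℤ) ^ 2 * 2 ^ (4 * m) + q.ζ₁ * r.num * (r.den : ℤ) ^ 3 * 2 ^ (4 * m)
      + q.ζ₀ * (r.den : ℤ) ^ 4 * 2 ^ (4 * m)
      + q.α * p * r.num ^ 2 * (r.den : ℤ) ^ 2 * 2 ^ (2 * m)
      + q.β * p * r.num * (r.den : ℤ) ^ 3 * 2 ^ (2 * m) + q.ε * p * (r.den : ℤ) ^ 4 * 2 ^ (2 * m)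
      + q.γ * p ^ 2 * (r.den : ℤ) ^ 4 : ℤ) : ℝ) =
      (r.den : ℝ) ^ 4 * ((2 : ℝ) ^ (2 * m)) ^ 2 * ((r : ℝ) ^ 4 + q.δ * (r : ℝ) ^ 3 + q.ζ₂ * (r : ℝ) ^ 2
        + q.ζ₁ * (r : ℝ) + q.ζ₀ + ((p : ℝ) / 2 ^ (2 * m)) * (q.α * (r : ℝ) ^ 2 + q.β * (r : ℝ) + q.ε)
        + q.γ * ((p : ℝ) / 2 ^ (2 * m)) ^ 2) := by
    push_cast
    rw [hnum, show (4 * m) = 2 * (2 * m) by ring, pow_mul']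
    field_simp
    ring
  rw [h, mul_zero] at key
  exact_mod_cast key

/-- (P2)+(P3) **the level SHAPE of the box** (node 29's `shape6` widened to nine coefficients): for `γ`, `p` odd and
`m ≥ 1`, an integer solution of the cleared equation has `den r = 2^m`, `num r` odd, and `W := num r` solves the
REDUCED equation
`W⁴ + δ2^mW³ + ζ₂2^{2m}W² + ζ₁2^{3m}W + ζ₀2^{4m} + αpW² + βp2^mW + εp2^{2m} + γp² = 0`. -/
theorem shape9 (q : SectorBox) {p : ℤ} (hγ : Odd q.γ) (hp : Odd p) {m : ℕ} (hm : 1 ≤ m) {r : ℚ}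
    (h : r.num ^ 4 * 2 ^ (4 * m) + q.δ * r.num ^ 3 * (r.den : ℤ) * 2 ^ (4 * m)
      + q.ζ₂ * r.num ^ 2 * (r.den : ℤ) ^ 2 * 2 ^ (4 * m) + q.ζ₁ * r.num * (r.den : ℤ) ^ 3 * 2 ^ (4 * m)
      + q.ζ₀ * (r.den : ℤ) ^ 4 * 2 ^ (4 * m)
      + q.α * p * r.num ^ 2 * (r.den : ℤ) ^ 2 * 2 ^ (2 * m)
      + q.β * p * r.num * (r.den : ℤ) ^ 3 * 2 ^ (2 * m) + q.ε * p * (r.den : ℤ) ^ 4 * 2 ^ (2 * m)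
      + q.γ * p ^ 2 * (r.den : ℤ) ^ 4 = 0) :
    (r.den : ℤ) = 2 ^ m ∧ Odd r.num ∧
      r.num ^ 4 + q.δ * 2 ^ m * r.num ^ 3 + q.ζ₂ * (2 ^ m) ^ 2 * r.num ^ 2 + q.ζ₁ * (2 ^ m) ^ 3 * r.num
        + q.ζ₀ * (2 ^ m) ^ 4 + q.α * p * r.num ^ 2 + q.β * p * 2 ^ m * r.num + q.ε * p * (2 ^ m) ^ 2
        + q.γ * p ^ 2 = 0 := by
  set a : ℤ := r.num with ha
  set d : ℕ := r.den with hd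
  -- (P2) `d ∣ a⁴·2^{4m}` and `d ⊥ a` ⟹ `d = 2^e`
  have hdvd : (d : ℤ) ∣ a ^ 4 * 2 ^ (4 * m) := by
    refine ⟨-(q.δ * a ^ 3 * 2 ^ (4 * m) + q.ζ₂ * a ^ 2 * (d : ℤ) * 2 ^ (4 * m)
      + q.ζ₁ * a * (d : ℤ) ^ 2 * 2 ^ (4 * m) + q.ζ₀ * (d : ℤ) ^ 3 * 2 ^ (4 * m)
      + q.α * p * a ^ 2 * (d : ℤ) * 2 ^ (2 * m)
      + q.β * p * a * (d : ℤ) ^ 2 * 2 ^ (2 * m) + q.ε * p * (d : ℤ) ^ 3 * 2 ^ (2 * m)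
      + q.γ * p ^ 2 * (d : ℤ) ^ 3), ?_⟩
    linear_combination h
  have hred : Nat.Coprime d a.natAbs := Nat.coprime_comm.mp r.reduced
  have hcop : IsCoprime (d : ℤ) (a ^ 4) := by
    refine IsCoprime.pow_right ?_
    rw [Int.isCoprime_iff_nat_coprime]
    simpa using hred
  have hd2 : (d : ℤ) ∣ 2 ^ (4 * m) := hcop.dvd_of_dvd_mul_left hdvd
  have hd2' : d ∣ 2 ^ (4 * m) := by exact_mod_cast hd2
  obtain ⟨e, -, hde⟩ := (Nat.dvd_prime_pow Nat.prime_two).1 hd2'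
  have hdeZ : (d : ℤ) = 2 ^ e := by exact_mod_cast hde
  rw [hdeZ] at h
  -- `a` is odd as soon as `e ≥ 1`
  have hodd_of : 1 ≤ e → Odd a := fun he => by
    refine Int.not_even_iff_odd.mp fun hae => ?_
    have h2d : 2 ∣ d := by
      rw [hde]; exact dvd_pow_self 2 (by omega)
    have h2a : 2 ∣ a.natAbs := by
      have := Int.natAbs_dvd_natAbs.mpr (even_iff_two_dvd.mp hae)
      simpa using this
    exact Nat.not_coprime_of_dvd_of_dvd one_lt_two h2d h2a hred
  -- (P3) `e = m`
  have hem : e = m := by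
    rcases Nat.lt_trichotomy e m with hlt | heq | hgt
    · -- `e < m`: `γ·p²` is even — absurd
      exfalso
      obtain ⟨t, rfl⟩ : ∃ t, m = e + 1 + t := ⟨m - e - 1, by omega⟩
      have key : ((2 : ℤ) ^ e) ^ 4 * (q.γ * p ^ 2 + 2 * (a ^ 4 * 2 ^ 3 * (2 ^ t) ^ 4
          + q.δ * a ^ 3 * 2 ^ e * 2 ^ 3 * (2 ^ t) ^ 4
          + q.ζ₂ * a ^ 2 * (2 ^ e) ^ 2 * 2 ^ 3 * (2 ^ t) ^ 4
          + q.ζ₁ * a * (2 ^ e) ^ 3 * 2 ^ 3 * (2 ^ t) ^ 4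
          + q.ζ₀ * (2 ^ e) ^ 4 * 2 ^ 3 * (2 ^ t) ^ 4
          + q.α * p * a ^ 2 * 2 * (2 ^ t) ^ 2 + q.β * p * a * 2 ^ e * 2 * (2 ^ t) ^ 2
          + q.ε * p * (2 ^ e) ^ 2 * 2 * (2 ^ t) ^ 2)) = 0 := by
        have e4 : (2 : ℤ) ^ (4 * (e + 1 + t)) = (2 ^ e) ^ 4 * 2 ^ 4 * (2 ^ t) ^ 4 := by
          rw [show 4 * (e + 1 + t) = e * 4 + 4 + t * 4 by ring, pow_add, pow_add, pow_mul, pow_mul]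
        have e2 : (2 : ℤ) ^ (2 * (e + 1 + t)) = (2 ^ e) ^ 2 * 2 ^ 2 * (2 ^ t) ^ 2 := by
          rw [show 2 * (e + 1 + t) = e * 2 + 2 + t * 2 by ring, pow_add, pow_add, pow_mul, pow_mul]
        rw [e4, e2] at h
        linear_combination h
      have h2e : ((2 : ℤ) ^ e) ^ 4 ≠ 0 := by positivity
      have hsum := (mul_eq_zero.mp key).resolve_left h2e
      have heven : Even (q.γ * p ^ 2) := ⟨-(a ^ 4 * 2 ^ 3 * (2 ^ t) ^ 4
          + q.δ * a ^ 3 * 2 ^ e * 2 ^ 3 * (2 ^ t) ^ 4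
          + q.ζ₂ * a ^ 2 * (2 ^ e) ^ 2 * 2 ^ 3 * (2 ^ t) ^ 4
          + q.ζ₁ * a * (2 ^ e) ^ 3 * 2 ^ 3 * (2 ^ t) ^ 4
          + q.ζ₀ * (2 ^ e) ^ 4 * 2 ^ 3 * (2 ^ t) ^ 4
          + q.α * p * a ^ 2 * 2 * (2 ^ t) ^ 2 + q.β * p * a * 2 ^ e * 2 * (2 ^ t) ^ 2
          + q.ε * p * (2 ^ e) ^ 2 * 2 * (2 ^ t) ^ 2), by linear_combination hsum⟩
      exact Int.not_even_iff_odd.mpr (hγ.mul (hp.pow)) heven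
    · exact heq
    · -- `e > m`: `a⁴` is even — absurd (`a` is odd since `e ≥ 1`)
      exfalso
      obtain ⟨t, rfl⟩ : ∃ t, e = m + 1 + t := ⟨e - m - 1, by omega⟩
      have key : ((2 : ℤ) ^ m) ^ 4 * (a ^ 4 + 2 * (q.δ * a ^ 3 * 2 ^ m * 2 ^ t
          + q.ζ₂ * a ^ 2 * (2 ^ m) ^ 2 * 2 * (2 ^ t) ^ 2
          + q.ζ₁ * a * (2 ^ m) ^ 3 * 2 ^ 2 * (2 ^ t) ^ 3
          + q.ζ₀ * (2 ^ m) ^ 4 * 2 ^ 3 * (2 ^ t) ^ 4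
          + q.α * p * a ^ 2 * 2 * (2 ^ t) ^ 2
          + q.β * p * a * 2 ^ m * 2 ^ 2 * (2 ^ t) ^ 3 + q.ε * p * (2 ^ m) ^ 2 * 2 ^ 3 * (2 ^ t) ^ 4
          + q.γ * p ^ 2 * 2 ^ 3 * (2 ^ t) ^ 4)) = 0 := by
        have e4 : (2 : ℤ) ^ (4 * m) = (2 ^ m) ^ 4 := by rw [pow_mul']
        have e2 : (2 : ℤ) ^ (2 * m) = (2 ^ m) ^ 2 := by rw [pow_mul']
        have e1 : (2 : ℤ) ^ (m + 1 + t) = 2 ^ m * 2 * 2 ^ t := by rw [pow_add, pow_add, pow_one]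
        rw [e4, e2, e1] at h
        linear_combination h
      have h2m : ((2 : ℤ) ^ m) ^ 4 ≠ 0 := by positivity
      have hsum := (mul_eq_zero.mp key).resolve_left h2m
      have heven : Even (a ^ 4) := ⟨-(q.δ * a ^ 3 * 2 ^ m * 2 ^ t
          + q.ζ₂ * a ^ 2 * (2 ^ m) ^ 2 * 2 * (2 ^ t) ^ 2
          + q.ζ₁ * a * (2 ^ m) ^ 3 * 2 ^ 2 * (2 ^ t) ^ 3
          + q.ζ₀ * (2 ^ m) ^ 4 * 2 ^ 3 * (2 ^ t) ^ 4
          + q.α * p * a ^ 2 * 2 * (2 ^ t) ^ 2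
          + q.β * p * a * 2 ^ m * 2 ^ 2 * (2 ^ t) ^ 3 + q.ε * p * (2 ^ m) ^ 2 * 2 ^ 3 * (2 ^ t) ^ 4
          + q.γ * p ^ 2 * 2 ^ 3 * (2 ^ t) ^ 4), by linear_combination hsum⟩
      exact Int.not_even_iff_odd.mpr ((hodd_of (by omega)).pow) heven
  subst hem
  refine ⟨hdeZ, hodd_of hm, ?_⟩
  have key : ((2 : ℤ) ^ e) ^ 4 * (a ^ 4 + q.δ * 2 ^ e * a ^ 3 + q.ζ₂ * (2 ^ e) ^ 2 * a ^ 2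
      + q.ζ₁ * (2 ^ e) ^ 3 * a + q.ζ₀ * (2 ^ e) ^ 4 + q.α * p * a ^ 2 + q.β * p * 2 ^ e * a
      + q.ε * p * (2 ^ e) ^ 2 + q.γ * p ^ 2) = 0 := by
    have e4 : (2 : ℤ) ^ (4 * e) = (2 ^ e) ^ 4 := by rw [pow_mul']
    have e2 : (2 : ℤ) ^ (2 * e) = (2 ^ e) ^ 2 := by rw [pow_mul']
    rw [e4, e2] at h
    linear_combination h
  have h2e : ((2 : ℤ) ^ e) ^ 4 ≠ 0 := by positivity
  exact (mul_eq_zero.mp key).resolve_left h2e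

/-- the left side of the REDUCED level equation of the box at level `N` (`2m = N!`) in the odd numerator
`a = num r`: `a⁴ + δ2^ma³ + ζ₂2^{2m}a² + ζ₁2^{3m}a + ζ₀2^{4m} + αp_Na² + βp_N2^ma + εp_N2^{2m} + γp_N²`. -/
def redLHS (q : SectorBox) (N m : ℕ) (a : ℤ) : ℤ :=
  a ^ 4 + q.δ * 2 ^ m * a ^ 3 + q.ζ₂ * (2 ^ m) ^ 2 * a ^ 2 + q.ζ₁ * (2 ^ m) ^ 3 * a + q.ζ₀ * (2 ^ m) ^ 4
    + q.α * (psNumer 2 N : ℤ) * a ^ 2 + q.β * (psNumer 2 N : ℤ) * 2 ^ m * a + q.ε * (psNumer 2 N : ℤ) * (2 ^ m) ^ 2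
    + q.γ * (psNumer 2 N : ℤ) ^ 2

/-- the exponent bookkeeping of a level `N ≥ 2` with `2m = N!`:
`1 ≤ m`, `m ≤ N! − (N−1)!`, `N! − (N−1)! ≤ 2m`, `N − 1 ≤ m`. -/
theorem level_exponents {N m : ℕ} (hN : 2 ≤ N) (hm : 2 * m = N !) :
    1 ≤ m ∧ m ≤ (N !) - (N - 1)! ∧ (N !) - (N - 1)! ≤ 2 * m ∧ N - 1 ≤ m := by
  obtain ⟨M, rfl⟩ : ∃ M, N = M + 1 := ⟨N - 1, by omega⟩
  have hM : 1 ≤ M := by omega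
  rw [Nat.add_sub_cancel]
  have hfac : (M + 1)! = (M + 1) * M ! := Nat.factorial_succ M
  have hsub : ((M + 1)!) - M ! = M * M ! := Nat.sub_eq_of_eq_add (by rw [hfac]; ring)
  rw [hsub]
  obtain ⟨F, hF⟩ : ∃ F, M ! = F := ⟨_, rfl⟩
  obtain ⟨Pr, hPr⟩ : ∃ Pr, M * M ! = Pr := ⟨_, rfl⟩
  have hF1 : 1 ≤ F := by rw [← hF]; exact Nat.factorial_pos M
  have hMF : M ≤ F := by rw [← hF]; exact Nat.self_le_factorial M
  have hFP : F ≤ Pr := by rw [← hPr, ← hF]; exact Nat.le_mul_of_pos_left _ (by omega)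
  have hm' : 2 * m = Pr + F := by rw [hfac, add_mul, one_mul, hPr, hF] at hm; exact hm
  rw [hPr]
  omega

/-- `K₀·2^{−m} ≤ 1` on large levels. -/
theorem eventually_K₀_small_ss (K₀ : ℝ) (hK₀ : 1 ≤ K₀) :
    ∃ N₅ : ℕ, ∀ N m : ℕ, N₅ ≤ N → 2 * m = N ! → K₀ * (1 / 2 : ℝ) ^ m ≤ 1 := by
  have hK₀pos : 0 < K₀ := by linarith
  obtain ⟨n, hn⟩ := exists_pow_lt_of_lt_one (show 0 < 1 / K₀ by positivity) (show (1 / 2 : ℝ) < 1 by norm_num)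
  refine ⟨n + 2, fun N m hN hm => ?_⟩
  have hN2 : 2 ≤ N := by omega
  obtain ⟨-, -, -, hmN⟩ := level_exponents hN2 hm
  have h1 : (1 / 2 : ℝ) ^ m ≤ (1 / 2 : ℝ) ^ n := pow_le_pow_of_le_one (by norm_num) (by norm_num) (by omega)
  calc K₀ * (1 / 2 : ℝ) ^ m ≤ K₀ * (1 / 2 : ℝ) ^ n := by gcongr
    _ ≤ K₀ * (1 / K₀) := by gcongr
    _ = 1 := by field_simp

end Summit.Schanuel.Schanuel.Theorems.RootDecomp1KSectorSubspace
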